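import Mathlib

/-!
# Injectivity of the trace encoding of exponents

Stub `stub_traceEncodingInjective` (S10a) for the crux `HilbertIntegralOverconvergentIsCongruence`
(line Sketch-ideate-r1-k1).  Hilbert modular `q`-expansions are indexed by elements `ν` of a
number field `F` of degree `d`; the line's algebraization engine moves them to exponents in `ℚ^d`
via `ν ↦ (Tr_{F/ℚ}(α_j ν))_j` for a `ℚ`-basis `α` of `F`.  This file proves that this encoding is
injective: the map is additive, and if `Tr(α_j ν) = 0` for all `j` then, `α` spanning `F` over `ℚ`
(`LinearIndependent.span_eq_top_of_card_eq_finrank'`), `Tr(x ν) = 0` for every `x : F`, whence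
`ν = 0` by non-degeneracy of the trace form of the separable extension `F/ℚ`
(`traceForm_nondegenerate`).
-/

set_option linter.dupNamespace false

noncomputable section

namespace Summit.Langlands.Langlands.Theorems.HilbertIntegralOverconvergentIsCongruence

/-- **stub S10a — `stub_traceEncodingInjective` (S; exponent encoding, injectivity).**  For a number field
`F` and a `ℚ`-linearly independent family `α : Fin d → F` with `d = [F:ℚ]`, the additive map
`ν ↦ (Tr_{F/ℚ}(α_j ν))_j : F → ℚ^d` is injective (non-degeneracy of the trace form, Mathlib
`Algebra.traceForm_nondegenerate`; `α` is a basis). [folklore] -/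
theorem stub_traceEncodingInjective (F : Type*) [Field F] [NumberField F] {d : ℕ} (α : Fin d → F)
    (hα : LinearIndependent ℚ α) (hd : d = Module.finrank ℚ F) :
    Function.Injective (fun ν : F ↦ fun j : Fin d ↦ Algebra.trace ℚ F (α j * ν)) := by
  -- `α` spans `F` over `ℚ` (linearly independent family of `finrank`-many vectors)
  have hspan : Submodule.span ℚ (Set.range α) = ⊤ :=
    hα.span_eq_top_of_card_eq_finrank' (by rw [Fintype.card_fin]; exact hd)
  -- the kernel of the encoding is trivial, by non-degeneracy of the trace form
  have key : ∀ ν : F, (∀ j : Fin d, Algebra.trace ℚ F (α j * ν) = 0) → ν = 0 := by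
    intro ν hν
    refine (traceForm_nondegenerate ℚ F).2 ν fun x => ?_
    rw [Algebra.traceForm_apply]
    have hx : x ∈ Submodule.span ℚ (Set.range α) := hspan ▸ Submodule.mem_top
    induction hx using Submodule.span_induction with
    | mem y hy =>
      obtain ⟨j, rfl⟩ := hy
      exact hν j
    | zero => rw [zero_mul, map_zero]
    | add y z _ _ hy hz => rw [add_mul, map_add, hy, hz, add_zero]
    | smul c y _ hy => rw [smul_mul_assoc, map_smul, hy, smul_zero]
  -- injectivity from additivity and the trivial kernel
  intro ν ν' h
  have h' : ∀ j : Fin d, Algebra.trace ℚ F (α j * (ν - ν')) = 0 := by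
    intro j
    have hj := congr_fun h j
    simp only at hj
    rw [mul_sub, map_sub, hj, sub_self]
  exact sub_eq_zero.mp (key _ h')

end Summit.Langlands.Langlands.Theorems.HilbertIntegralOverconvergentIsCongruence

end
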